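import Literature.Probability.FitznerVanDerHofstad2017.Stage1Frame
import Literature.Probability.FitznerVanDerHofstad2017.NoGoFrameScope

/-!
# Literature.Probability.FitznerVanDerHofstad2017.Stage1FrameScope — the typed no-go speaks about Definition 2.9's class in `Γ₂`

CITATION HEADER (PLACEMENT v2). Part of the certified REPRODUCTION of R. Fitzner, R. van der Hofstad, *Mean-field
behavior for nearest-neighbor percolation in d > 10*, EJP 22 (2017) no. 43 [FvdH17] and *Generalized approach to the
non-backtracking lace expansion*, PTRF 169 (2017) 1041–1119 [NoBLE17]; build `lace`, seat lean1 (gen 5), REFEREE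
C15 (ii, instance half) / REFEREE2 R9.  This module carries NO verdict and NO numerical literal; it is additive over
`Stage1Frame` and `NoGoFrameScope` (no declaration of those modules is changed).

THE POINT.  `NoGoFrameScope` shows at frame level that a point closing the bootstrap in every respect except the
standing inequality `1 < Γ₂` (`Frame.ClosesP`) has `Γ₂ > 1` anyway, PROVIDED its App. D inputs at some point `s` are
well formed and `μ̲[s] ≤ z_I`.  In the typed instance `Stage1Cells.Data` these provisos were so far available only in
the cone above a floor `y₀` with `1 ≤ Γ₂(y₀)` (`Data.Std`, used by `Data.Std.val0_i_le_o` to order the atom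
`VarGamma2[i] ≤ VarGamma2[o]`, i.e. the point `i` below the point `o`).  This module removes the proviso for the typed
frame WITHOUT touching `Data.Std`: at the INITIAL point `s = i` no comparison of the two points is needed (the
coefficient `(2d−2) (μ̄/μ)[i] z_I⁴` of cell 37 is dominated by the main part of the SAME point), and the signs of all
cells at a state `y` need only the signs of its coordinates (`0 ≤ Γ₁`, `0 ≤ Γ₂`, `0 ≤ c_j`), which every `ClosesP`
point has (`Γ₁ > 1`, `Γ₂ > boundF2 > 0`, `c_j > boundF3[j,i] ≥ 0`).  Hence, for every typed frame under its standing
hypotheses (at ANY floor — only their table and dimension facts are used): `ClosesP y ↔ Closes y`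
(`Data.Std.closesP_iff`), and every no-go theorem about `Closes` is a theorem about `ClosesP`
(`Data.Std.noGoP_of_noGo`, `Data.Std.noGoP_all_floor`, whose box floors keep `Γ₂ = 1`) — the typed NO-GO speaks about
the class `0 ≤ γ₂ < Γ₂` of [NoBLE17] Definition 2.9 (2.14), not only about `Γ₂ > 1`; in particular the
generalisation of `Data.Std` to floors with `Γ₂(y₀) < 1` foreseen in `NoGoFrameScope` (SCOPE (iii)) is not needed.
The restriction `1 < Γ₁` ([NoBLE17] Lemma 2.1: `1 ≤ γ₁ < Γ₁`) is untouched (see `NoGoFrameScope`, SCOPE (i)).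

WHAT IS PROVIDED.  A floor-free sign layer for the typed cells at a state with non-negative coordinates
(`Data.Std.val0_nonneg'`, `ev0_nonneg'`, `val_nonneg'`, `ev_nonneg'`, the two bracketed cells at the initial point /
at both points, `muMin_le_zIr`), the well-formedness of the App. D inputs at the initial point of a `ClosesP` state
(`Data.Std.wf_i_of_closesP`), and the instance theorems `Data.Std.one_lt_Gamma2_of_closesP`, `Data.Std.closesP_iff`,
`Data.Std.noGoP_of_noGo`, `Data.Std.noGoP_all_floor`.

References: [NoBLE17] arXiv:1506.07969 / PTRF 169: Lemma 2.1 (arXiv p. 10), Definition 2.9 (2.14)–(2.16) and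
Theorem 2.10 (PTRF p. 1060), App. D (D.2)–(D.3) (PTRF pp. 1110–1117); [FvdH17] notebook `Percolation.nb` cells 3, 9,
10, 37, 44, 47, 56 (transcript `HOME/b2b-lace-num3/published/Percolation.txt` l.171–175, l.334–343, l.361–363,
l.1035–1055, l.1214–1237, l.1303, l.1440–1447, in this order; `cell n` = the n-th `### [Input]` block of that
transcript, as in the LOCATORS paragraph of `Stage1Cells.lean`; cell 37 = the `Bound[Xi,alpha,…]` /
`Bound[Psi,alphaI|alphaII,…]` block, its `Psi,alphaI` formulas at l.1046–1049; cell 56 = the `SuccesF` block,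
`0 < boundF2[s] < Gamma2` at l.1442).

LOCATOR REVISION (REFEREE v21 F11 / C34, docstring-only, seat lean1 gen 6): the cell-37 locator of this header and of
`Std.coef_le_main_i`, `Std.psiAlphaI01_nonneg_i`, `Std.psiAlphaII01_nonneg'` previously pointed at transcript lines
791 to 815 (the `Bound[hi,…]` lines of cells 26–27, not cell 37) and now reads `l.1035–1055` (= `Stage1Cells.lean`,
cell 37); the header's line list was made one-to-one with its cell list.  No declaration, statement, proof or
numeral of this module changed.
-/

namespace Literature.Probability.FitznerVanDerHofstad2017
namespace Stage1Cells

open NoGoFrame F3Bounds BetaMap PX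

namespace Data

variable {ν : Type*} {D : Data ν} {y₀ y : State}

section Scope
variable (H : D.Std y₀)
include H

/-! ### A floor-free sign layer: the cells are `≥ 0` at any state with non-negative coordinates -/

/-- `z[s] ≥ 0` for `Γ₁ ≥ 0`. [folklore] -/
theorem Std.zAt_nonneg' (hG1 : 0 ≤ y.Gamma1) : ∀ s, 0 ≤ D.zAt s y
  | .i => le_of_lt (one_div_pos.2 H.den_pos)
  | .o => div_nonneg hG1 H.den_pos.le

/-- `VarGamma2[s] ≥ 0` for `Γ₂ ≥ 0`. [folklore] -/
theorem Std.VAt_nonneg' (hG2 : 0 ≤ y.Gamma2) : ∀ s, 0 ≤ D.VAt s y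
  | .i => div_nonneg (by linarith [H.two_le_dR]) H.den_pos.le
  | .o => mul_nonneg hG2 (div_nonneg (by linarith [H.two_le_dR]) H.den_pos.le)

/-- the weighted constants are `≥ 0` for `c_j ≥ 0`. [folklore] -/
theorem Std.cAt_nonneg' (hc : ∀ j, 0 ≤ y.c j) : ∀ s j, 0 ≤ D.cAt s y j
  | .i, j => H.initCell_nonneg j
  | .o, j => hc j

/-- the basic valuation is `≥ 0` at a state with non-negative coordinates. [folklore] -/
theorem Std.val0_nonneg' (hG1 : 0 ≤ y.Gamma1) (hG2 : 0 ≤ y.Gamma2) (hc : ∀ j, 0 ≤ y.c j) (s : Pt) :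
    ∀ a, 0 ≤ D.val0 s y a
  | .z => H.zAt_nonneg' hG1 s
  | .V => H.VAt_nonneg' hG2 s
  | .cw j => H.cAt_nonneg' hc s j
  | .Vo => H.VAt_nonneg' hG2 .o
  | .G13at _ => le_rfl
  | .mubOverMu => le_rfl
  | .mubOverMuI => le_rfl
  | .hdInv => le_rfl

/-- every cell is `≥ 0` under the basic valuation at such a state. [folklore] -/
theorem Std.ev0_nonneg' (hG1 : 0 ≤ y.Gamma1) (hG2 : 0 ≤ y.Gamma2) (hc : ∀ j, 0 ≤ y.c j) (s : Pt) (e : T) :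
    0 ≤ D.ev0 s y e :=
  eval_nonneg (H.val0_nonneg' hG1 hG2 hc s) H.tabs.val_nonneg e

/-- `Bound[G,{1},3,s] ≥ 0` at such a state. [folklore] -/
theorem Std.g13_nonneg' (hG1 : 0 ≤ y.Gamma1) (hG2 : 0 ≤ y.Gamma2) (hc : ∀ j, 0 ≤ y.c j) (s : Pt) :
    0 ≤ D.g13 s y := H.ev0_nonneg' hG1 hG2 hc s _

/-- the full valuation is `≥ 0` at such a state while the two geometric ratios are `< 1`. [folklore] -/
theorem Std.val_nonneg' (hG1 : 0 ≤ y.Gamma1) (hG2 : 0 ≤ y.Gamma2) (hc : ∀ j, 0 ≤ y.c j)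
    (hg : ∀ t, D.g13 t y < 1) (s : Pt) (hob : D.ob1 s y < 1) : ∀ a, 0 ≤ D.val s y a
  | .G13at t => H.g13_nonneg' hG1 hG2 hc t
  | .mubOverMu => inv_one_sub_nonneg (hg s)
  | .mubOverMuI => inv_one_sub_nonneg (hg .i)
  | .hdInv => inv_one_sub_nonneg hob
  | .z => H.zAt_nonneg' hG1 s
  | .V => H.VAt_nonneg' hG2 s
  | .cw j => H.cAt_nonneg' hc s j
  | .Vo => H.VAt_nonneg' hG2 .o

/-- On the validity region every cell is `≥ 0` at a state with non-negative coordinates (no floor). [folklore] -/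
theorem Std.ev_nonneg' (hG1 : 0 ≤ y.Gamma1) (hG2 : 0 ≤ y.Gamma2) (hc : ∀ j, 0 ≤ y.c j) (hU : D.U y) (s : Pt)
    (e : T) : 0 ≤ D.ev s y e :=
  eval_nonneg (H.val_nonneg' hG1 hG2 hc (fun t => (hU t).g13) s (hU s).ob1) H.tabs.val_nonneg e

/-- `mumin[s] ≤ z_I` (cell 44: `mumin[s] = z_I (1 − max(Bound[G,{1},3,s], Bound[G,{1},3,i]))` with both bounds
`≥ 0`). [cite: FitznerVanDerHofstad2017, notebook Percolation.nb cell 44 (transcript l.1214–1216)] -/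
theorem Std.muMin_le_zIr (hG1 : 0 ≤ y.Gamma1) (hG2 : 0 ≤ y.Gamma2) (hc : ∀ j, 0 ≤ y.c j) (s : Pt) :
    D.muMin s y ≤ D.zIr := by
  unfold muMin
  have h0 : 0 ≤ max (D.g13 s y) (D.g13 .i y) := le_max_of_le_left (H.g13_nonneg' hG1 hG2 hc s)
  have h1 : D.zIr * (1 - max (D.g13 s y) (D.g13 .i y)) ≤ D.zIr * 1 :=
    mul_le_mul_of_nonneg_left (by linarith) H.zIr_nonneg
  linarith

/-- `mumin[s] < 1` at such a state. [folklore] -/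
theorem Std.muMin_lt_one' (hG1 : 0 ≤ y.Gamma1) (hG2 : 0 ≤ y.Gamma2) (hc : ∀ j, 0 ≤ y.c j) (s : Pt) :
    D.muMin s y < 1 :=
  (H.muMin_le_zIr hG1 hG2 hc s).trans_lt H.zIr_lt_one

/-- AT THE INITIAL POINT the coefficient of cell 37 is dominated by the main part of the same point:
`(2d−2) (μ̄/μ)[i] z_I⁴ ≤ (μ̄/μ)[i] z_I² ((2d−2) z_I² + 4(d−1) G + G' + (4d−3) G″²)` — no comparison of the two points
is involved. [cite: FitznerVanDerHofstad2017, notebook Percolation.nb cell 37 (transcript l.1035–1055)] -/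
theorem Std.coef_le_main_i (hG1 : 0 ≤ y.Gamma1) (hG2 : 0 ≤ y.Gamma2) (hc : ∀ j, 0 ≤ y.c j) (hU : D.U y) :
    D.ev .i y (PsiAlphaI01coef D.P) ≤ D.ev .i y (PsiAlphaI01main D.P) := by
  have E := H.ev_nonneg' hG1 hG2 hc hU Pt.i
  have hk : 0 ≤ ((2 * D.P.d - 2 : ℕ) : ℝ) := Nat.cast_nonneg _
  have hzI : 0 ≤ D.zIr := H.zIr_nonneg
  have hmI : 0 ≤ 1 / (1 - D.g13 .i y) := inv_one_sub_nonneg ((hU .i).g13)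
  have hA := E (Gik4 D.P)
  have hB := E (Gtwoi2 D.P)
  have hG := E (G13 D.P ^ 2)
  have hk' : 0 ≤ ((4 * (D.P.d - 1) : ℕ) : ℝ) := Nat.cast_nonneg _
  have hk'' : 0 ≤ ((4 * D.P.d - 3 : ℕ) : ℝ) := Nat.cast_nonneg _
  have hzI_eval : D.ev .i y (zI D.P) = D.zIr := by
    simp only [ev, zI, eval_divN, eval_C, Nat.cast_one, H.cast_two_d_sub_one]; rfl
  have hzAt : D.zAt .i y = D.zIr := rfl
  have step2 : ((2 * D.P.d - 2 : ℕ) : ℝ) * (1 / (1 - D.g13 .i y)) * D.zIr ^ 4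
      ≤ D.ev .i y (PsiAlphaI01main D.P) := by
    simp only [ev, PsiAlphaI01main, eval_mul, eval_add, eval_C, eval_hpow, z, val_z, eval_atom, mubOverMu,
      val_mubOverMu, hzAt] at hA hB hG ⊢
    have hR : 0 ≤ ((4 * (D.P.d - 1) : ℕ) : ℝ) * eval (D.val .i y) (D.tabs.val D.P.d) (Gik4 D.P)
        + eval (D.val .i y) (D.tabs.val D.P.d) (Gtwoi2 D.P)
        + ((4 * D.P.d - 3 : ℕ) : ℝ) * eval (D.val .i y) (D.tabs.val D.P.d) (G13 D.P) ^ 2 :=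
      add_nonneg (add_nonneg (mul_nonneg hk' hA) hB) (mul_nonneg hk'' hG)
    have hprod := mul_nonneg (mul_nonneg hmI (pow_nonneg hzI 2)) hR
    nlinarith [hprod]
  have hcoef : D.ev .i y (PsiAlphaI01coef D.P) = ((2 * D.P.d - 2 : ℕ) : ℝ) * (1 / (1 - D.g13 .i y)) * D.zIr ^ 4 := by
    rw [← hzI_eval]; simp only [ev, PsiAlphaI01coef, eval_mul, eval_C, eval_hpow, eval_atom, val_mubOverMuI]
  rw [hcoef]; exact step2

/-- `Bound[Psi,alphaI,0−1,AroundEi,i] ≥ 0` at the initial point of a state of the validity region with non-negative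
coordinates: `main + coef (1 − 2P) ≥ main − coef ≥ 0` for `P ∈ [0,1]`. [cite: FitznerVanDerHofstad2017, notebook Percolation.nb cell 37 (transcript l.1035–1055)] -/
theorem Std.psiAlphaI01_nonneg_i (hG1 : 0 ≤ y.Gamma1) (hG2 : 0 ≤ y.Gamma2) (hc : ∀ j, 0 ≤ y.c j) (hU : D.U y) :
    0 ≤ D.psiAlphaI01 .i y := by
  unfold psiAlphaI01
  have E := H.ev_nonneg' hG1 hG2 hc hU Pt.i
  have U := hU .i
  have hA1 : D.ev .i y (PsiAlphaI01brA D.P) ≤ 1 := by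
    have h := E (vartheta D.P)
    have hm := le_max_left (D.ev .i y (Gik2 D.P)) (D.ev .i y (Gtwoi2 D.P))
    have h5 := U.br5b
    simp only [ev, PsiAlphaI01brA, pi1Br5b, pi1Br3b, pi1Br4b, theta2, eval_add, eval_mul, eval_C, eval_max,
      Nat.cast_ofNat] at h hm h5 ⊢
    linarith
  have hB1 : D.ev .i y (PsiAlphaI01brB D.P) ≤ 1 := by
    have h := E (vartheta D.P)
    have h5 := U.brIIB
    simp only [ev, PsiAlphaII01brB, eval_add] at h h5 ⊢; linarith
  have hp := prod_mem (E (PsiAlphaI01brA D.P)) hA1 (E (PsiAlphaI01brB D.P)) hB1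
  have hcf := E (PsiAlphaI01coef D.P)
  have hmc := H.coef_le_main_i hG1 hG2 hc hU
  nlinarith

/-- `Bound[Psi,alphaII,0−1,AroundZero,s] ≥ 0` at a state of the validity region with non-negative coordinates.
[cite: FitznerVanDerHofstad2017, notebook Percolation.nb cell 37 (transcript l.1035–1055)] -/
theorem Std.psiAlphaII01_nonneg' (hG1 : 0 ≤ y.Gamma1) (hG2 : 0 ≤ y.Gamma2) (hc : ∀ j, 0 ≤ y.c j) (hU : D.U y)
    (s : Pt) : 0 ≤ D.psiAlphaII01 s y := by
  unfold psiAlphaII01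
  have E := H.ev_nonneg' hG1 hG2 hc hU s
  have hp := (prod_mem (E (PsiAlphaII01brA D.P)) (hU s).brIIA (E (PsiAlphaII01brB D.P)) (hU s).brIIB).2
  have hm := E (PsiAlphaII01main D.P)
  have hcf := E (PsiAlphaII01coef D.P)
  nlinarith

/-- THE APP. D INPUTS AT THE INITIAL POINT ARE SIGNED CORRECTLY at any state of the validity region with non-negative
coordinates (no floor, no comparison of the two points). [folklore] -/
theorem Std.inp_i_nonneg (hG1 : 0 ≤ y.Gamma1) (hG2 : 0 ≤ y.Gamma2) (hc : ∀ j, 0 ≤ y.c j) (hU : D.U y) :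
    (D.inp y .i).Nonneg := by
  have E := H.ev_nonneg' hG1 hG2 hc hU Pt.i
  constructor
  all_goals first
    | exact E _
    | exact H.muMin_lt_one' hG1 hG2 hc _
    | exact H.psiAlphaI01_nonneg_i hG1 hG2 hc hU
    | exact H.psiAlphaII01_nonneg' hG1 hG2 hc hU _
    | exact le_rfl

/-! ### The typed frame: `ClosesP` points have well-formed inputs at the initial point, hence `Γ₂ > 1` -/

/-- A `ClosesP` point of the typed frame has non-negative coordinates: `Γ₁ > 1`, `Γ₂ > boundF2[o] > 0`,
`c_j > boundF3[j,i] ≥ 0`. [folklore] -/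
theorem Std.signs_of_closesP (hP : D.frame.ClosesP y) :
    0 ≤ y.Gamma1 ∧ 0 ≤ y.Gamma2 ∧ ∀ j, 0 ≤ y.c j :=
  ⟨zero_le_one.trans hP.one_lt_Gamma1.le, hP.Gamma2_pos.le,
    fun j => (H.initCell_nonneg j).trans (le_of_lt (by simpa [frame_initCell] using hP.f3init j))⟩

/-- THE APP. D INPUTS OF A `ClosesP` POINT ARE WELL FORMED AT THE INITIAL POINT (`0 ≤ m < 1`, `μ̲ ≥ 0`, `tmp2 < 1` are
fields of `ClosesP`; the signs are `Std.inp_i_nonneg`). [folklore] -/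
theorem Std.wf_i_of_closesP (hP : D.frame.ClosesP y) : ((D.frame.S y).inp .i).WF D.frame.d := by
  obtain ⟨hG1, hG2, hc⟩ := H.signs_of_closesP hP
  exact
    { toNonneg := H.inp_i_nonneg hG1 hG2 hc hP.stage1
      mu_nonneg := hP.m_pos.le
      mu_lt_one := hP.m_lt_one
      muMin_nonneg := hP.muMin_nonneg .i
      tmp2_lt_one := hP.tmp2_lt_one .i }

/-- `μ̲[s] ≤ z_I = 1/(2d−1)` at a `ClosesP` point of the typed frame. [folklore] -/
theorem Std.muMin_le_of_closesP (hP : D.frame.ClosesP y) (s : Pt) :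
    ((D.frame.S y).inp s).muMin ≤ 1 / (2 * D.frame.d - 1) := by
  obtain ⟨hG1, hG2, hc⟩ := H.signs_of_closesP hP
  exact H.muMin_le_zIr hG1 hG2 hc s

/-- **`Γ₂ > 1` IS AUTOMATIC FOR THE TYPED FRAME.**  Under the standing hypotheses (at any floor) a point of the typed
frame closing the bootstrap in every respect except the standing inequality `1 < Γ₂` has `Γ₂ > 1`: its improved bound
`boundF2[i] ≥ 1` (`Frame.one_le_F2`: (2.2)/(2.16) prefactor `(2d−1)/(2d−2) = 2d z_I/(1 − z_I²)`, `c̄_Φ ≥ 1`,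
`β_Δ ≥ 0`) while closing asks `boundF2[i] < Γ₂` (cell 56).
[cite: FitznerVanDerHofstad2016NoBLE, Definition 2.9 (2.14)–(2.16) and Theorem 2.10, p. 1060; Lemma 2.1, arXiv p. 10] -/
theorem Std.one_lt_Gamma2_of_closesP (hP : D.frame.ClosesP y) : 1 < y.Gamma2 :=
  hP.one_lt_Gamma2 H.two_le_dR (H.wf_i_of_closesP hP) (H.muMin_le_of_closesP hP .i)

/-- For the typed frame the class of Definition 2.9 in `Γ₂` and the class of Lemma 2.1 close alike:
`ClosesP y ↔ Closes y`. [cite: FitznerVanDerHofstad2016NoBLE, Definition 2.9 (2.14), p. 1060; Lemma 2.1, arXiv p. 10] -/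
theorem Std.closesP_iff : D.frame.ClosesP y ↔ D.frame.Closes y :=
  ⟨fun hP => hP.toCloses (H.one_lt_Gamma2_of_closesP hP), fun hC => hC.toClosesP⟩

/-- Every no-go theorem of the typed frame about `Closes` is a theorem about `ClosesP`. [folklore] -/
theorem Std.noGoP_of_noGo (hng : ¬ ∃ y, D.frame.Closes y) : ¬ ∃ y, D.frame.ClosesP y :=
  fun ⟨y, hP⟩ => hng ⟨y, (H.closesP_iff).1 hP⟩

omit H in
/-- **THE TYPED NO-GO ON DEFINITION 2.9's CLASS.**  `NoGoFrame.Frame.noGo_all_floor` for the typed frame with the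
conclusion on `ClosesP`: if the standing hypotheses hold at some floor and every box of a cover of `[0, 1)` in `m`
is discharged above its floor `(1, a, 1, c₀)` (`c₀ ≤ boundF3[·,i]`), then NO state `(Γ₁, m, Γ₂, c)` of the typed frame
satisfies `ClosesP` — i.e. no tuple with `Γ₁ > 1` closes the bootstrap, with NO standing condition on `Γ₂` at all
(Definition 2.9 (2.14) asks only `Γ₂ > γ₂ ≥ 0`).  The floors keep `Γ₂ = 1`: by `Std.one_lt_Gamma2_of_closesP` every
`ClosesP` point lies above them.
[cite: FitznerVanDerHofstad2016NoBLE, Definition 2.9 (2.14)–(2.16) and Theorem 2.10, p. 1060] -/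
theorem Std.noGoP_all_floor (H : D.Std y₀) (c₀ : Fin 6 → ℝ) (hc : ∀ j, c₀ j ≤ D.frame.initCell j)
    (boxes : List (ℝ × ℝ)) (hcover : ∀ m : ℝ, 0 ≤ m → m < 1 → ∃ ab ∈ boxes, ab.1 ≤ m ∧ m ≤ ab.2)
    (hbox : ∀ ab ∈ boxes, ¬ ∃ y,
      ({ Gamma1 := 1, m := ab.1, Gamma2 := 1, c := c₀ } : State) ≤ y ∧ (y.m ≤ ab.2 ∧ D.frame.Closes y)) :
    ¬ ∃ y, D.frame.ClosesP y :=
  H.noGoP_of_noGo (Frame.noGo_all_floor c₀ hc boxes hcover hbox)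

end Scope

end Data

end Stage1Cells
end Literature.Probability.FitznerVanDerHofstad2017
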